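import Mathlib
import Summits.NavierStokesRegularity.NavierStokesRegularity.Theses.EulerZoomLiouville
import Summits.NavierStokesRegularity.NavierStokesRegularity.Theorems.EulerZoomLiouvillePowerGaugeEulerLiouvilleLargeRho
import Summits.NavierStokesRegularity.NavierStokesRegularity.Theorems.EulerZoomLiouvillePowerGaugeEulerLiouvillePastSteady
import Summits.NavierStokesRegularity.NavierStokesRegularity.Theorems.EulerZoomLiouvillePowerGaugeEulerLiouvillePastIrrotational
import Literature.Analysis.FluidPDE.ClassicalSolution
import Literature.Analysis.FluidPDE.VectorCalculus
import HarnessLib.Audit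

/-!
# Line `logtime-breathers` (ideator ns-idea-11 g0, lens «complete» = program-completion) for the crux
# `EulerZoomLiouville.PowerGaugeEulerLiouville` (stmt-NavierStokesRegularity-19832)

PROGRAMME COMPLETED.  Chae's exclusion programme for (generalized / asymptotically) self-similar Euler singularities —
D. Chae, Math. Ann. 338 (2007) doi:10.1007/s00208-007-0082-6; J. Funct. Anal. 258 (2010) 2865–2883 doi:10.1016/j.jfa.2010.02.006
(Thm 1.2: no α-asymptotically self-similar blow-up for `α ∈ (−1, ∞)`; Thm 1.3: a Type-II-rate profile must be a STEADY Euler flow);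
Comm. Math. Phys. 305 (2011) doi:10.1007/s00220-011-1266-1 — is stated over the scaling family
`v ↦ λ^α v(λx, λ^{α+1} t)` with the endpoint `α = −1` EXCLUDED: at `α = −1` time is not rescaled, the one-parameter groups are
"dilate space AND translate time", and their fixed points are the EXPONENTIALLY SELF-SIMILAR ancient flows ("log-time breathers")
`u(τ, y) = e^{cτ} V(e^{−cτ} y)`, `p = e^{2cτ} P(e^{−cτ} y)` (`u(τ+s, ·) = e^{cs} u(τ, e^{−cs} ·)` for all `s`), profile system
`c (V − z·∇V) + V·∇V + ∇P = 0`, `div V = 0`, vorticity form `(V − c z)·∇Ω = Ω·∇V`.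
Gauge arithmetic does NOT exclude them for `c > 0` (tails `|V| ~ |z|^{−1−ρ}` pass `A`, `E`, `D`), and in the lead's partition (`birth` v28)
they sit in the open `stub_nonSelfSimilarRest` (not self-similar / DSS / periodic / steady; `sup|∇u(τ)| = ‖∇V‖_∞` is constant in `τ`, so
neither vorticity-tame nor classical-concentrating).

THE LEVER (new on this crux): INWARD CHARACTERISTICS.  For `c > 0` the profile transport field `W = V − c z` points INTO every large
ball (radial component `≤ −c|z|/2` outside `B(2‖V‖_∞/c)`), `div W = −3c` so the backward-trapped set is Lebesgue-null, and along a.e. backward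
`W`-characteristic `|z(s)| → ∞` exponentially; for a TAME profile (`‖∇V(z)‖ ≤ C(1+|z|)^{−1−ε}`) the stretching integral `∫‖∇V(z(s))‖ds`
converges and `Ω → 0` at infinity, so `Ω ≡ 0`; a bounded harmonic (curl- and divergence-free) profile is constant and the `A`-gauge makes it
zero.  This is the MIRROR IMAGE of the lead's landed obstruction for power-law self-similar profiles (OUTWARD drift `γ z`: vorticity has to be
imported along fast-inflow NEEDLES) — at the `α = −1` endpoint the drift sign flips and the import is automatic, killing the profile.
For `c < 0` (breathers expanding into the past) the `A`-gauge alone kills (`∫_{B(a)}|u(τ)|² = e^{5cτ} ∫_{B(a e^{−cτ})}|V|² = a⁵ ∫_{B(1)}|V|²`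
at the time `e^{−cτ} = 1/a`).
CLOCK RIGIDITY (the programme's frame, stub T1): a classical member that is SHAPE-PRESERVING, `u(τ,y) = θ(τ) V(y/ℓ(τ))` with positive
differentiable clocks, has exponential clocks (breather), power-law clocks about some `T₀ ≥ 0` (exactly self-similar with SOME exponent —
the lead's strata fix the class exponent `γ = 1/(2+ρ)`; SLOW-CLOCK members `γ' ∈ [2/5, 1/(2+ρ))` with steeper tails `|V| ~ |z|^{1−1/γ'}`
survive gauge arithmetic for `ρ < 1/2` and are flagged here for the lead), or is steady on the past (landed filler
`PastSteady.ae_eq_zero_of_gauge_of_pastSteady`).  The composition is kernel-checked; sorries live only in `stub_*`.  No summit is proved by a line.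
-/

open MeasureTheory Set Filter Topology Metric
open scoped ENNReal NNReal
open Literature.Analysis Literature.Analysis.FluidPDE

set_option linter.dupNamespace false

namespace Summit.NavierStokesRegularity.NavierStokesRegularity.Cruxes.PowerGaugeEulerLiouville.LogtimeBreathers

/-- Local abbreviation: ℝ³. -/
abbrev E3 : Type := EuclideanSpace ℝ (Fin 3)

/-- Membership in Seregin's power-gauged ancient Euler class — verbatim the three hypotheses of the crux (same as `Birth.InClass`). -/
@[reducible] def InClass (ρ : ℝ) (u : ℝ → E3 → E3) (p : ℝ → E3 → ℝ) (H : ℝ → E3 → E3 →L[ℝ] E3)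
    (c : ℝ≥0) : Prop :=
  IsSuitableWeakSolutionOn (slab (EuclideanSpace ℝ (Fin 3)) (Set.Iio 0) isOpen_Iio) 0 0 u p ∧
    HasWeakSpatialGradientOn (slab (EuclideanSpace ℝ (Fin 3)) (Set.Iio 0) isOpen_Iio) u H ∧
    (∀ a : ℝ, 0 < a →
      ENNReal.ofReal (a ^ (2 * ρ)) * cknA a (0 : ℝ × E3) u + ENNReal.ofReal (a ^ ρ) * cknE a (0 : ℝ × E3) H +
        ENNReal.ofReal (a ^ (2 * ρ)) * cknD a (0 : ℝ × E3) p ≤ (c : ℝ≥0∞))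

/-- The conclusion of the crux: `u` vanishes a.e. on the past slab. -/
@[reducible] def VanishesAE (u : ℝ → E3 → E3) : Prop :=
  Function.uncurry u =ᵐ[volume.restrict (Set.Iio (0 : ℝ) ×ˢ (Set.univ : Set E3))] 0

/-- SHAPE-PRESERVING member ("generalized self-similar" in Chae's sense): `u(τ, y) = θ(τ) V(y/ℓ(τ))` for all `τ < 0` with positive
differentiable amplitude and length clocks `θ, ℓ` and a fixed profile `V`. -/
def IsShapePreserving (u : ℝ → E3 → E3) : Prop :=
  ∃ (θ ℓ : ℝ → ℝ) (V : E3 → E3),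
    (∀ τ : ℝ, τ < 0 → 0 < θ τ ∧ 0 < ℓ τ) ∧ DifferentiableOn ℝ θ (Set.Iio 0) ∧ DifferentiableOn ℝ ℓ (Set.Iio 0) ∧
      ∀ τ : ℝ, τ < 0 → ∀ y : E3, u τ y = θ τ • V ((ℓ τ)⁻¹ • y)

/-- LOG-TIME BREATHER with rate `c` and profile `V` (the `α = −1` endpoint of Euler's scaling family, EXPONENTIAL self-similarity):
`u(τ, y) = e^{cτ} V(e^{−cτ} y)` for all `τ < 0`; `c > 0` contracts toward `τ → +∞` and fades into the past, `c < 0` expands into the past. -/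
def IsLogtimeBreather (u : ℝ → E3 → E3) (c : ℝ) (V : E3 → E3) : Prop :=
  c ≠ 0 ∧ ∀ τ : ℝ, τ < 0 → ∀ y : E3, u τ y = Real.exp (c * τ) • V (Real.exp (-(c * τ)) • y)

/-- POWER CLOCK: exactly self-similar about some time `T₀ ≥ 0` with SOME exponent `γ ∈ ℝ` (the lead's `IsExactlySelfSimilar` is the case
`T₀ = 0`, `γ = 1/(2+ρ)`): `u(τ, y) = (T₀ − τ)^{γ−1} V((T₀ − τ)^{−γ} y)` for all `τ < 0`. -/
def IsPowerClock (u : ℝ → E3 → E3) : Prop :=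
  ∃ (T₀ γ : ℝ) (V : E3 → E3), 0 ≤ T₀ ∧ ∀ τ : ℝ, τ < 0 → ∀ y : E3, u τ y = (T₀ - τ) ^ (γ - 1) • V ((T₀ - τ) ^ (-γ) • y)

/-- STEADY PAST (whole past): `u(τ, ·) = v` for every `τ < 0`. -/
def IsSteadyPast (u : ℝ → E3 → E3) : Prop :=
  ∃ v : E3 → E3, ∀ τ : ℝ, τ < 0 → u τ = v

/-- TAME profile: pointwise gradient decay `‖∇V(z)‖ ≤ C (1 + ‖z‖)^{−(1+ε)}` for some `ε > 0` (makes the stretching integral along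
exponentially escaping characteristics converge and forces `curl V → 0` at infinity). -/
def IsTameProfile (V : E3 → E3) : Prop :=
  ∃ C ε : ℝ, 0 < ε ∧ ∀ z : E3, ‖fderiv ℝ V z‖ ≤ C * (1 + ‖z‖) ^ (-(1 + ε))

/-! ## Registered stub signatures -/

/-- Signature of `stub_clockRigidity` (T1, size M/L, provable): in the window, a CLASSICAL shape-preserving member is a log-time breather, or a
power clock about some `T₀ ≥ 0`, or steady on the past.  (Substituting `y = ℓ(τ) z` turns Euler into
`θ' V − θ(ℓ'/ℓ) z·∇V + (θ²/ℓ) V·∇V = ∇q_τ` in `z`; the set of `(α,β)` with `αV + β z·∇V + V·∇V` a gradient is an affine subspace of `ℝ²`: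
a point ⇒ `θ'ℓ/θ² = A`, `ℓ'/θ = B` constant ⇒ `ℓ' = Cℓ^k` ⇒ exponential (`k = 1`) or power law about `T₀ ≥ 0` (`ℓ > 0` on all of `(−∞,0)`
forbids a finite past collapse) or steady.  DEGENERATE BRANCH (`dim ≥ 1`; idea-crit-8 price P1⁗, 2026-08-28T03:14:57Z — the earlier
shortcut «`∂_τ u` is a harmonic gradient» is wrong when the direction has `β₁ ≠ 0` and the `β = 0` point has `α* ≠ 0`): close it by CURL
HOMOGENEITY instead — a direction with `β₁ ≠ 0` gives `z·∇V = mV + ∇q`, hence `z·∇Ω = (m−1)Ω` for `Ω = curl V`, so `Ω` is smooth and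
positively homogeneous of degree `m − 1`, i.e. a homogeneous polynomial (degree `m−1 ∈ ℕ`) or `0`; a nonzero homogeneous polynomial vorticity
gives `∫_{B(a)}|∇u(τ)|² ≥ ½θ²ℓ ∫_{B(a/ℓ)}|Ω|² ~ a^{3+2(m−1)} ≫ a^{1−ρ}`, contradicting the `E`-gauge, so `Ω ≡ 0`, `V` is a harmonic gradient of
sub-volume growth (`A`-gauge) ⇒ `V = 0` ⇒ `u` steady (trivially); a direction with `β₁ = 0`, `α₁ ≠ 0` forces `V = ∇q` directly, same end.  The
prover may split this branch off as a support lemma `clockRigidity_degenerate`.) -/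
def Sig.stub_clockRigidity : Prop :=
  ∀ ρ : ℝ, 0 < ρ → ρ ≤ 1 / 2 → ∀ (u : ℝ → E3 → E3) (p : ℝ → E3 → ℝ) (H : ℝ → E3 → E3 →L[ℝ] E3) (c : ℝ≥0),
    InClass ρ u p H c → IsClassicalEulerSolutionOn (Set.Iio 0) 0 u p → IsShapePreserving u →
      (∃ (c' : ℝ) (V : E3 → E3), IsLogtimeBreather u c' V) ∨ IsPowerClock u ∨ IsSteadyPast u

/-- Signature of `stub_pastExpandingBreather` (T2a, size M, provable): a breather with `c' < 0` (expanding into the past) is trivial —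
`A`-gauge arithmetic: `∫_{B(a)}|u(τ)|² = e^{5c'τ} ∫_{B(a e^{−c'τ})}|V|²`, which at the time with `e^{−c'τ} = R/a` equals `(a/R)^5 ∫_{B(R)}|V|²`,
incompatible with `≤ c a^{1−2ρ}` for large `a` unless `V = 0` a.e.  MEASURABILITY (idea-crit-8 price P2⁗): `IsLogtimeBreather` carries no
measurability of `V` and there is no classical hypothesis here — pull a.e.-strong measurability of one slice `u(τ,·)` (hence of `V`) from the
suitable-weak-solution data in `InClass` (`IsSuitableWeakSolutionOn` ⇒ `uncurry u` locally integrable on the slab ⇒ a.e. slice measurable, Fubini)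
before concluding `lintegral = 0 ⇒ V = 0` a.e. -/
def Sig.stub_pastExpandingBreather : Prop :=
  ∀ ρ : ℝ, 0 < ρ → ρ ≤ 1 / 2 → ∀ (u : ℝ → E3 → E3) (p : ℝ → E3 → ℝ) (H : ℝ → E3 → E3 →L[ℝ] E3) (c : ℝ≥0),
    InClass ρ u p H c → ∀ (c' : ℝ) (V : E3 → E3), c' < 0 → IsLogtimeBreather u c' V → VanishesAE u

/-- Signature of `stub_tameBreather` (T2b, size L, THE CORE, provable): in the window, a CLASSICAL log-time breather with `c' > 0` and a TAME
profile is trivial — inward characteristics of `W = V − c'z` (`div W = −3c'`, backward-trapped set null, a.e. backward characteristic escapes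
exponentially), convergent stretching integral, `curl V → 0` at infinity ⇒ `curl V ≡ 0`; then every slice `u(τ)` is `C²`, divergence free and
irrotational and the landed `PastIrrotational.ae_eq_zero_of_gauge_of_pastIrrotational` (`T₁ = 0`) concludes.  NAMED SUPPORT TARGETS
(idea-crit-8 price P3⁗; none is in tree — Mathlib has only the linear `MeasureTheory.Measure.addHaar_image_linearMap`; land each
`--supports stmt-NavierStokesRegularity-19832`): (S-a) `tameBreather_flow` — the `C¹` field `W = V − c'z` (`V` bounded, `C¹` with bounded
derivative) has a global flow `Φ : ℝ × E3 → E3`, `C¹` in `z`; (S-b) `tameBreather_liouvilleVolume` — `volume (Φ s '' A) = ofReal (exp (−3c's)) *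
volume A` for measurable `A` (Liouville/Jacobi: `det DΦ_s` solves `d/ds log det = div W ∘ Φ_s = −3c'`); (S-c) `tameBreather_trappedNull` — the
backward-invariant set `{z : ∀ s ≤ 0, ‖Φ s z‖ ≤ R₁}` is null (volume scaled by `e^{3c'|s|}` yet bounded); (S-d) `tameBreather_gronwall` — along a
characteristic, `‖Ω(z)‖ ≤ ‖Ω(Φ s z)‖ * exp (∫₀^{|s|} ‖DV(Φ σ z)‖ dσ)` from `W·∇Ω = DV·Ω − (div W)Ω/…` (here `(V − c'z)·∇Ω = DV·Ω`, no extra term);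
(S-e) `tameProfile_bounded_curl_tendsto_zero` — `IsTameProfile V` ⇒ `V` bounded and `curl V z → 0` as `‖z‖ → ∞`. -/
def Sig.stub_tameBreather : Prop :=
  ∀ ρ : ℝ, 0 < ρ → ρ ≤ 1 / 2 → ∀ (u : ℝ → E3 → E3) (p : ℝ → E3 → ℝ) (H : ℝ → E3 → E3 →L[ℝ] E3) (c : ℝ≥0),
    InClass ρ u p H c → IsClassicalEulerSolutionOn (Set.Iio 0) 0 u p →
      ∀ (c' : ℝ) (V : E3 → E3), 0 < c' → IsLogtimeBreather u c' V → IsTameProfile V → VanishesAE u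

/-- Signature of `stub_wildBreatherRest` (T3, OPEN, thin — not claimed): classical breathers with `c' > 0` whose profile is NOT tame
(gradient decaying slower than `|z|^{−1−ε}` pointwise, although `∫_{B(a)}|V|² ≤ c a^{1−2ρ}` and `∫_{B(a)}|∇V|² ≲ a^{1−ρ}` hold by the gauges at
`τ → 0⁻`) are trivial.  The analogue, at the `α = −1` endpoint, of the lead's needle/weak residue. -/
def Sig.stub_wildBreatherRest : Prop :=
  ∀ ρ : ℝ, 0 < ρ → ρ ≤ 1 / 2 → ∀ (u : ℝ → E3 → E3) (p : ℝ → E3 → ℝ) (H : ℝ → E3 → E3 →L[ℝ] E3) (c : ℝ≥0),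
    InClass ρ u p H c → IsClassicalEulerSolutionOn (Set.Iio 0) 0 u p →
      ∀ (c' : ℝ) (V : E3 → E3), 0 < c' → IsLogtimeBreather u c' V → ¬ IsTameProfile V → VanishesAE u

/-- Signature of `stub_powerClockRest` (T4, OPEN — not claimed): in the window, classical POWER-CLOCK members (exactly self-similar about some
`T₀ ≥ 0` with some exponent `γ`) are trivial.  Contains `birth` v28's open self-similar residue (`T₀ = 0`, `γ = 1/(2+ρ)`: `stub_selfSimilarC2Needle`,
`stub_selfSimilarWeakRest`, its many FILLED sub-strata, and the shifted `IsShiftedSelfSimilar` strata — reusable by name) and one family the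
lead's partition does not name: SLOW-CLOCK exactly self-similar members with exponent `γ ∈ [2/5, 1/(2+ρ))` (tails `|V(z)| ~ |z|^{1−1/γ}` steeper
than critical; they pass `A` iff `2/5 ≤ γ ≤ 1/(2+ρ)`, `E`/`D` iff `γ ≤ 1/2 − ρ/6`; non-empty exactly for `ρ < 1/2`). -/
def Sig.stub_powerClockRest : Prop :=
  ∀ ρ : ℝ, 0 < ρ → ρ ≤ 1 / 2 → ∀ (u : ℝ → E3 → E3) (p : ℝ → E3 → ℝ) (H : ℝ → E3 → E3 →L[ℝ] E3) (c : ℝ≥0),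
    InClass ρ u p H c → IsClassicalEulerSolutionOn (Set.Iio 0) 0 u p → IsPowerClock u → VanishesAE u

/-- Signature of `stub_shapelessRest` (T5, OPEN, crux-sized — not claimed): in the window, members that are NOT classical shape-preserving
(weak members; classical members whose shape changes in time) are trivial.  The honest residue. -/
def Sig.stub_shapelessRest : Prop :=
  ∀ ρ : ℝ, 0 < ρ → ρ ≤ 1 / 2 → ∀ (u : ℝ → E3 → E3) (p : ℝ → E3 → ℝ) (H : ℝ → E3 → E3 →L[ℝ] E3) (c : ℝ≥0),
    InClass ρ u p H c → ¬ (IsClassicalEulerSolutionOn (Set.Iio 0) 0 u p ∧ IsShapePreserving u) → VanishesAE u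

/-! ## Stubs -/

/-- STUB T1 [provable, M/L]: clock rigidity of shape-preserving classical members. -/
theorem stub_clockRigidity : Sig.stub_clockRigidity := by
  sorry

/-- STUB T2a [provable, M]: past-expanding breathers (`c' < 0`) die by `A`-gauge arithmetic. -/
theorem stub_pastExpandingBreather : Sig.stub_pastExpandingBreather := by
  sorry

/-- STUB T2b [provable, L — THE CORE]: tame breathers (`c' > 0`) die by inward characteristics. -/
theorem stub_tameBreather : Sig.stub_tameBreather := by
  sorry

/-- STUB T3 [OPEN, thin, not claimed]: wild (non-tame) breathers. -/
theorem stub_wildBreatherRest : Sig.stub_wildBreatherRest := by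
  sorry

/-- STUB T4 [OPEN, not claimed]: power clocks (⊇ the lead's self-similar residue; + wrong-exponent and shifted families). -/
theorem stub_powerClockRest : Sig.stub_powerClockRest := by
  sorry

/-- STUB T5 [OPEN residue, not claimed]: everything not classical shape-preserving. -/
theorem stub_shapelessRest : Sig.stub_shapelessRest := by
  sorry

/-! ## Composition -/

/-- **Composition (kernel-checked, no sorry of its own): the six stubs (+ the landed large-`ρ` and past-steady fillers) give the crux BY NAME.** -/
theorem PowerGaugeEulerLiouville_of :
    Sig.stub_clockRigidity → Sig.stub_pastExpandingBreather → Sig.stub_tameBreather → Sig.stub_wildBreatherRest →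
      Sig.stub_powerClockRest → Sig.stub_shapelessRest →
      Summit.NavierStokesRegularity.NavierStokesRegularity.Theses.EulerZoomLiouville.PowerGaugeEulerLiouville := by
  intro h1 h2a h2b h3 h4 h5 ρ hρ u p H c hsw hH hc
  by_cases hhalf : 1 / 2 < ρ
  · exact
      Summit.NavierStokesRegularity.NavierStokesRegularity.Theorems.PowerGaugeEulerLiouville.powerGaugeEulerLiouville_largeRho
        ρ hhalf u p H c hsw hH hc
  · have hρ2 : ρ ≤ 1 / 2 := not_lt.mp hhalf
    by_cases hcs : IsClassicalEulerSolutionOn (Set.Iio 0) 0 u p ∧ IsShapePreserving u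
    · rcases h1 ρ hρ hρ2 u p H c ⟨hsw, hH, hc⟩ hcs.1 hcs.2 with ⟨c', V, hbr⟩ | hpc | ⟨v, hv⟩
      · rcases lt_or_gt_of_ne hbr.1 with hneg | hpos
        · exact h2a ρ hρ hρ2 u p H c ⟨hsw, hH, hc⟩ c' V hneg hbr
        · by_cases htame : IsTameProfile V
          · exact h2b ρ hρ hρ2 u p H c ⟨hsw, hH, hc⟩ hcs.1 c' V hpos hbr htame
          · exact h3 ρ hρ hρ2 u p H c ⟨hsw, hH, hc⟩ hcs.1 c' V hpos hbr htame
      · exact h4 ρ hρ hρ2 u p H c ⟨hsw, hH, hc⟩ hcs.1 hpc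
      · exact
          Summit.NavierStokesRegularity.NavierStokesRegularity.Theorems.PowerGaugeEulerLiouville.PastSteady.ae_eq_zero_of_gauge_of_pastSteady
            hρ hsw hH hc (T₁ := 0) le_rfl (v := v) hv
    · exact h5 ρ hρ hρ2 u p H c ⟨hsw, hH, hc⟩ hcs

end Summit.NavierStokesRegularity.NavierStokesRegularity.Cruxes.PowerGaugeEulerLiouville.LogtimeBreathers
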